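import Summits.BirchSwinnertonDyer.BirchSwinnertonDyer.Theorems.CumulativeHeegnerLeopoldtEisensteinCharacterInvariantsAtThreeAlgLambdaDoor
import Summits.BirchSwinnertonDyer.BirchSwinnertonDyer.Theorems.SchneiderFreeAdditiveX3KYBranchThreeOfCGLS
import Summits.BirchSwinnertonDyer.BirchSwinnertonDyer.Theorems.SchneiderFreeAdditiveX3GordTwoBranchIMCOfTree
import HarnessLib

/-!
# Route `CumulativeHeegnerLeopoldt`, crux K2-odd `EisensteinCharacterInvariantsAtThreeOdd` (stmt-BirchSwinnertonDyer-23970), line `birth` v11: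
# the DOOR HALF of [ALG-λ] and the λ-FORMULA `stub_algLambdaFormula` RE-KEYED OFF GREENBERG — CGLS 2022 Thm. 1.5.1's λ-formula on the
# Leopoldt cell modulo FOUR published facts (CGLS 2022 Prop. 1.2.5 module clause, Prop. 14, Cor. 1.2.6 (i), (ii)) + the curve-side
# inequality (helper, `--supports stmt-BirchSwinnertonDyer-23970`)

Prover `leafhand-bsd-cumulativeheegnerl-1` g0 (cell `bsd-eis`). The tree file `…EisensteinCharacterInvariantsAtThreeAlgLambdaDoor` (p705629,
lead `bsd-line-chl-p1` g10) assembles the λ-formula of the registered stub `stub_algLambdaFormula` (line `birth` v3–v6; a THEOREM of the v11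
skeleton modulo the PRINT stub `stub_algLambdaPrintedFacts`) from cell `bsd-schneider-ideate`'s count
`KYNonAnomalousTwist.lambdaInvariant_xAc_empty_add_zpCorank_eq_add_add_sum_of_nonAnomalous_of_facts` GRANTED EIGHT named facts — CGLS 2022
Prop. 1.2.5 (module clause), Prop. 14, Cor. 1.2.6 (i)(ii); Greenberg 2016 Props. 4.1.1 (`prop411_selmer_isAlmostDivisible`), 2.6.3
(`prop263_sur_of_crk`); Greenberg 2006 Props. 4.1, 3.2 — seven of which form the registered 7-conjunction `stub_algLambdaPrintedFacts`.

Since 2026-08-29/30 cell `bsd-schneider-ideate` (seat `bsd-schneider-door-c5`, generation 40, F38a/`…KYBranchThreeOfCGLS`) has the SAME count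
GREENBERG-FREE: `KYLambdaAlgOfCGLS.lambdaInvariant_xAc_empty_add_zpCorank_eq_add_add_sum_of_nonAnomalous_ofCGLS`, token-identical signature with
`(h411, h263, h41, h42, h5A, h32) ↦ (hge, hPT)` where `hge` = CGLS Prop. 1.2.5's CORANK clause (`prop125_characterGrSelmerDual_corank_ge`) and
`hPT` = Milne ADT I Thm. 4.10 (a) at finite `S` over totally complex fields. Both replacements are TREE THEOREMS by now:
* `hPT` := `PoitouTateShaNaturalAtTC.forall_poitouTate_shaRestricted_tateDual_natural_at_of_isTotallyComplex` (lane «PT-Ш-S-TC» END theorem);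
* `hge` := cell `bsd-schneider-ideate`'s `SchneiderFreeAdditiveX3.KYBranchOfTree.corank_ge_ofTree` (F41 `corank_ge_ofPT` fed with the same
  «PT-Ш-S-TC» END theorem) applied to the module clause `hprop125` itself.

THIS FILE re-types p705629 token for token with that one engine call re-keyed (everything else — cell `bsd-eis`'s unconditional
`FSideCorankLeOffP` bound, the strict = unramified bridge `StrictEqUnramifiedCentral`, this lineage's `…AnyLine` / `…LocalTermsAtP` bookkeeping —
unchanged):
* `door_identity_and_le_ofCGLS`, `door_ofCGLS`, `formula_iff_corank_ofCGLS`, `formula_ofCGLS_of_corankGe` — p705629's four theorems with the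
  hypothesis list `(hprop125 hfact hlift hlocal h411 h263 h41 h32)` cut to `(hprop125 hfact hlift hlocal)`; statements after the fact binders
  VERBATIM (binders of `stub_algLambdaFormula`).

CONSEQUENCE for the line (evidence for the LEAD; no registry verb here): [ALG-λ] = `stub_algLambdaFormula` ⟸ {CGLS Prop. 1.2.5 (module),
Prop. 14, Cor. 1.2.6 (i), (ii)} ∧ [ALG-≥] (curve side, itself ⟸ Prop. 14 by the sister file `…CurveRelaxationOfTree` + p708936); i.e. the
registered PRINT stub `stub_algLambdaPrintedFacts` (7 conjuncts) is consumed only through its conjuncts 1–3 — Greenberg 2016 Props. 4.1.1,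
2.6.3 and Greenberg 2006 Props. 4.1, 3.2 LEAVE crux 23970's input ledger.

HONEST FRAMING: compositions of tree theorems; CONDITIONAL BY NAME on four PUBLISHED facts typed as `Prop`s (not proved in the tree) and, for the
formula, on the displayed inequality; no definition, no named fact introduced, no `sorry`; closes no stub by itself. BSD is not proved for any
curve by any of this.
References: [CastellaGrossiLeeSkinner2022] §1.2 Prop. 1.2.5, Cor. 1.2.6, Prop. 14, §1.4 Props. 1.4.1–1.4.2, Thm. 1.5.1 (arXiv:2008.02571v2;
Invent. Math. 227 (2022)); [KellerYin2024] Prop. 1.2.5, Thm. 1.4.1, Thm. 1.5.1 (arXiv:2402.12781v2); [GreenbergVatsal2000] §2 Cor. (2.3), Prop. (2.4);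
[MilneADT2006] I Thms. 4.10 (a), 5.1; [Greenberg2016Selmer] Prop. 2.6.3 (c); [Greenberg2006] Props. 4.1, 4.2, §5 A; [Harari2020] Thm. 17.13 (a);
[PollackWeston2011] App. A Prop. A.2; tree p705629, `…KYBranchThreeOfCGLS` (F38a), `…GordTwoBranchIMCOfTree` (`corank_ge_ofTree`),
`…PoitouTateShaNaturalAtTC`.
-/

set_option autoImplicit false
-- `…BirchSwinnertonDyer.BirchSwinnertonDyer.Theorems…` is the problem's mandated namespace (D-0017).
set_option linter.dupNamespace false

noncomputable section

open scoped Classical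

namespace Summit.BirchSwinnertonDyer.BirchSwinnertonDyer.Theorems.EisensteinCharacterInvariantsAtThreeAlgLambdaDoorOfCGLS

open WeierstrassCurve NumberField IsDedekindDomain Field
  Literature.NumberTheory.EllipticCurves Literature.NumberTheory.EllipticCurves.GreenbergSelmer
  Literature.NumberTheory.EllipticCurves.GreenbergVatsal2000 Literature.NumberTheory.GaloisRepresentations
  Literature.NumberTheory.EllipticCurves.Rank1Residual Literature.NumberTheory.EllipticCurves.KellerYin2024
  Literature.NumberTheory.EllipticCurves.CastellaGrossiLeeSkinner2022
  Literature.NumberTheory.IwasawaTheory Literature.NumberTheory.IwasawaTheory.Greenberg2016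
  Literature.NumberTheory.IwasawaTheory.Greenberg2006
  Summit.BirchSwinnertonDyer.BirchSwinnertonDyer.Theorems

/-- **The door identity at the CHL binders, for the stub's UNRAMIFIED primitive duals, modulo FOUR published facts (CGLS 2022 Prop. 1.2.5 module clause, Prop. 14, Cor. 1.2.6 (i), (ii)) — Greenberg-free:**
for every `Sf′` = the places of `K` over `N` prime to 3,
`λ(X_{∅,0}(𝔭′)) + corank_{ℤ_3}(Sel_{𝔭′}^{Sf′}/Sel_{𝔭′}^∅) = λ(Dsub.X) + λ(Dquot.X) + Σ_{w∈Sf′}(λ𝒫_w(θsub) + λ𝒫_w(θquot))` AND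
`corank ≤ Σ_{w∈Sf′} λ𝒫_w(f)` (cell `bsd-schneider-ideate`'s count + cell `bsd-eis`'s bridge and bound, fed with the cell bookkeeping
of this lineage; the count is cell `bsd-schneider-ideate`'s GREENBERG-FREE F38a form). CONDITIONAL on the four named facts; closes nothing.
[cite: CastellaGrossiLeeSkinner2022, §1.2 Prop. 1.2.5, Cor. 1.2.6, Prop. 14, §1.4, Thm. 1.5.1] [cite: GreenbergVatsal2000, §2 Cor. (2.3), Prop. (2.4)]
[cite: Greenberg2016Selmer, Prop. 2.6.3 (c)] [cite: Greenberg2006, Props. 4.1, 4.2, §5 A] [cite: MilneADT2006, I Thms. 4.10 (a), 5.1] -/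
theorem door_identity_and_le_ofCGLS
    (hprop125 : prop125_characterGrSelmerDual_torsion_muZero_dim) (hfact : prop14_residualCharacterSelmer_finite)
    (hlift : cor126_residualCharacter_globalLift) (hlocal : cor126_residualCharacter_localSurjective) :
    ∀ (W : WeierstrassCurve ℚ) [W.IsElliptic] [W.IsGloballyMinimal] (N : ℕ) [NeZero N] (K : Type) [Field K] [NumberField K], Summit.BirchSwinnertonDyer.Rank1Residual.Additive.ClassO6 W 3 → Literature.NumberTheory.EllipticCurves.Rank1Residual.Red W 3 → (∃ Φ : AddSubgroup (WeierstrassCurve.geomTorsion W ((3 : ℕ) : ℤ)), Literature.NumberTheory.EllipticCurves.Rank1Residual.IsRationalLine W 3 Φ ∧ ∀ (v : IsDedekindDomain.HeightOneSpectrum (NumberField.RingOfIntegers ℚ)), ((3 : ℕ) : NumberField.RingOfIntegers ℚ) ∈ v.asIdeal → ∀ 𝔓 ∈ v.primesAbove, ¬ (∀ g ∈ 𝔓.decompositionSubgroup (Field.absoluteGaloisGroup ℚ), ∀ P ∈ Φ, g • P = P) ∧ ¬ (∀ g ∈ 𝔓.decompositionSubgroup (Field.absoluteGaloisGroup ℚ),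 ∀ P : WeierstrassCurve.geomTorsion W ((3 : ℕ) : ℤ), g • P - P ∈ Φ)) → W.conductorNorm ℤ = N → Literature.NumberTheory.EllipticCurves.IsImaginaryQuadratic K → Literature.NumberTheory.EllipticCurves.SatisfiesHeegnerHypothesis N K → Odd (NumberField.discr K) → (∀ Q : (W.baseChange K).toAffine.Point, (3 : ℕ) • Q = 0 → Q = 0) → ∀ (κ : Literature.NumberTheory.EllipticCurves.ZpExtension K 3), κ.IsAnticyclotomic → ∀ (γ : Field.absoluteGaloisGroup K) [Fact (κ.IsTopGenerator γ)] (𝔭 : IsDedekindDomain.HeightOneSpectrum (NumberField.RingOfIntegers K)), ((3 : ℕ) : NumberField.RingOfIntegers K) ∈ 𝔭.asIdeal → 𝔭.asIdeal.ramificationIdx (NumberField.RingOfIntegers ℚ) = 1 → 𝔭.asIdeal.inertiaDeg (NumberField.RingOfIntegers ℚ) = 1 → ∀ (𝔭' : IsDedekindDomain.HeightOneSpectrum (NumberField.RingOfIntegers K)), ((3 : ℕ) : NumberField.RingOfIntegers K) ∈ 𝔭'.asIdeal → 𝔭' ≠ 𝔭 → ∀ (θsub θquot : FramedGaloisRep K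 (padicCoeffIntegers (∅ : Set (PadicAlgCl 3))) 1), Literature.NumberTheory.EllipticCurves.KellerYin2024.IsResidualPairOver (W.baseChange K) 3 θsub θquot → ∀ (Sf : Finset (IsDedekindDomain.HeightOneSpectrum (NumberField.RingOfIntegers K))), (∀ w : IsDedekindDomain.HeightOneSpectrum (NumberField.RingOfIntegers K), w ∈ Sf ↔ ((W.conductorNorm ℤ : ℤ) : NumberField.RingOfIntegers K) ∈ w.asIdeal) → ∀ (Dsub : Literature.NumberTheory.EllipticCurves.GreenbergVatsal2000.DatumDualData κ γ (Literature.NumberTheory.EllipticCurves.KellerYin2024.charModule (∅ : Set (PadicAlgCl 3)) θsub) (Literature.NumberTheory.EllipticCurves.Castella2018.AcSelmer.bdpData (Literature.NumberTheory.EllipticCurves.KellerYin2024.charModule (∅ : Set (PadicAlgCl 3)) θsub) 3 𝔭') ∅) (Dquot : Literature.NumberTheory.EllipticCurves.GreenbergVatsal2000.DatumDualData κ γ (Literature.NumberTheory.EllipticCurves.KellerYin2024.charModule (∅ : Set (PadicAlgCl 3)) θquot) (Literature.NumberTheory.EllipticCurves.Castella2018.AcSelmer.bdpData (Literature.NumberTheory.EllipticCurves.KellerYin2024.charModule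 (∅ : Set (PadicAlgCl 3)) θquot) 3 𝔭') ∅),
      ∀ (Sf' : Finset (IsDedekindDomain.HeightOneSpectrum (NumberField.RingOfIntegers K))), (∀ w : IsDedekindDomain.HeightOneSpectrum (NumberField.RingOfIntegers K), w ∈ Sf' ↔ (((W.conductorNorm ℤ : ℤ) : NumberField.RingOfIntegers K) ∈ w.asIdeal ∧ ((3 : ℕ) : NumberField.RingOfIntegers K) ∉ w.asIdeal)) →
      (Literature.NumberTheory.EllipticCurves.lambdaInvariant 3 (Summit.BirchSwinnertonDyer.Rank1Residual.X11b.AcSelmer.XAc (W.baseChange K) 3 κ 𝔭' ∅ γ) +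
          Literature.NumberTheory.EllipticCurves.zpCorank (↥(Summit.BirchSwinnertonDyer.Rank1Residual.X11b.AcSelmer.selmerAc (W.baseChange K) 3 κ 𝔭' (↑Sf' : Set (IsDedekindDomain.HeightOneSpectrum (NumberField.RingOfIntegers K)))) ⧸ (Summit.BirchSwinnertonDyer.Rank1Residual.X11b.AcSelmer.selmerAc (W.baseChange K) 3 κ 𝔭' (∅ : Set (IsDedekindDomain.HeightOneSpectrum (NumberField.RingOfIntegers K)))).addSubgroupOf (Summit.BirchSwinnertonDyer.Rank1Residual.X11b.AcSelmer.selmerAc (W.baseChange K) 3 κ 𝔭' (↑Sf' : Set (IsDedekindDomain.HeightOneSpectrum (NumberField.RingOfIntegers K))))) 3 =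
        Literature.NumberTheory.EllipticCurves.lambdaInvariant 3 Dsub.X + Literature.NumberTheory.EllipticCurves.lambdaInvariant 3 Dquot.X +
          ∑ w ∈ Sf', (Literature.NumberTheory.EllipticCurves.KellerYin2024.charLocalLambda (∅ : Set (PadicAlgCl 3)) κ θsub w + Literature.NumberTheory.EllipticCurves.KellerYin2024.charLocalLambda (∅ : Set (PadicAlgCl 3)) κ θquot w)) ∧
      Literature.NumberTheory.EllipticCurves.zpCorank (↥(Summit.BirchSwinnertonDyer.Rank1Residual.X11b.AcSelmer.selmerAc (W.baseChange K) 3 κ 𝔭' (↑Sf' : Set (IsDedekindDomain.HeightOneSpectrum (NumberField.RingOfIntegers K)))) ⧸ (Summit.BirchSwinnertonDyer.Rank1Residual.X11b.AcSelmer.selmerAc (W.baseChange K) 3 κ 𝔭' (∅ : Set (IsDedekindDomain.HeightOneSpectrum (NumberField.RingOfIntegers K)))).addSubgroupOf (Summit.BirchSwinnertonDyer.Rank1Residual.X11b.AcSelmer.selmerAc (W.baseChange K) 3 κ 𝔭' (↑Sf' : Set (IsDedekindDomain.HeightOneSpectrum (NumberField.RingOfIntegers K))))) 3 ≤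
        ∑ w ∈ Sf', Literature.NumberTheory.EllipticCurves.KellerYin2024.curveLocalLambda κ (W.baseChange K) w := by
  intro W _ _ N _ K _ _ hO6 hRed hcell hN hK hHN hodd hEK κ hκ γ hγI 𝔭 h𝔭 he hf 𝔭' h𝔭' hne θsub θquot hpair Sf hSf Dsub Dquot Sf' hSf'
  haveI : Fact (Nat.Prime 3) := ⟨Nat.prime_three⟩
  haveI hEKi : (W.baseChange K).IsElliptic := inferInstanceAs (W.map (algebraMap ℚ K)).IsElliptic
  subst hN
  -- CGLS Prop. 1.2.5's corank clause and Milne ADT I Thm. 4.10 (a) at finite `S` over totally complex fields: TREE THEOREMS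
  have hge : prop125_characterGrSelmerDual_corank_ge := SchneiderFreeAdditiveX3.KYBranchOfTree.corank_ge_ofTree hprop125
  have hPT : ∀ (L : Type) [Field L] [NumberField L] [IsTotallyComplex L] (S : Set (HeightOneSpectrum (𝓞 L))),
      S.Finite → Literature.NumberTheory.GaloisCohomology.poitouTate_shaRestricted_tateDual_natural_at L S :=
    PoitouTateShaNaturalAtTC.forall_poitouTate_shaRestricted_tateDual_natural_at_of_isTotallyComplex
  -- `(3) = 𝔭𝔭′` split (Heegner hypothesis at `3 ∣ N`)
  have h3N : 3 ∣ W.conductorNorm ℤ := (W.dvd_conductorNorm_iff_not_hasGoodReductionAtPrime 3).mpr hO6.2.1.1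
  have hsplit : ((Ideal.span {((3 : ℕ) : ℤ)}).primesOver (𝓞 K)).ncard = 2 := hHN 3 Nat.prime_three h3N
  -- the non-anomalous clause for EVERY order-3 subgroup, from the cell's one rational line
  obtain ⟨Φ₀, hΦ₀, hcell₀⟩ := hcell
  have hna : ∀ (v : HeightOneSpectrum (𝓞 ℚ)), ((3 : ℕ) : 𝓞 ℚ) ∈ v.asIdeal →
      ∀ (Φ : AddSubgroup (geomTorsion W ((3 : ℕ) : ℤ))), Nat.card Φ = 3 →
      ∀ 𝔓 ∈ v.primesAbove,
        (¬ ∀ g ∈ 𝔓.decompositionSubgroup (absoluteGaloisGroup ℚ), ∀ P ∈ Φ, g • P = P) ∧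
          (¬ ∀ g ∈ 𝔓.decompositionSubgroup (absoluteGaloisGroup ℚ),
            ∀ P : geomTorsion W ((3 : ℕ) : ℤ), g • P - P ∈ Φ) :=
    fun v hv Φ hΦ 𝔓 h𝔓 ↦
      EisensteinCharacterInvariantsAtThreeAnyLine.nonanomalous_of_nonanomalous
        (W.natCard_geomTorsion_prime_eq_sq Nat.prime_three) hΦ hΦ₀.1 hΦ₀.2 _ (hcell₀ v hv 𝔓 h𝔓)
  -- the GREENBERG-FREE count of cell `bsd-schneider-ideate` (F38a) for all STRICT primitive duals
  have key := SchneiderFreeAdditiveX3.KYLambdaAlgOfCGLS.lambdaInvariant_xAc_empty_add_zpCorank_eq_add_add_sum_of_nonAnomalous_ofCGLS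
    hprop125 hge hfact hlift hlocal hPT W K 𝔭' κ γ Sf' (by norm_num) hRed hK hHN hsplit h𝔭 h𝔭' hne hκ hSf' hna
    θsub θquot hpair
  -- cell `bsd-eis`'s unconditional `corank ≤ Σ λ𝒫_w(f)`
  have hle := FSideCorankLeOffP.zpCorank_selmerAc_quotient_le_sum_curveLocalLambda_of_offP_iff W (by norm_num) hK hHN κ hκ
    hγI.out 𝔭' Sf' hSf'
  -- the strict = unramified bridge for both characters (Teichmüller, non-trivial on `D_𝔭′`)
  obtain ⟨-, hchar⟩ := SchneiderFreeAdditiveX3.KYLambdaAlgChar.charHypotheses_of_nonAnomalous W K 𝔭' κ Sf' hK hHN hsplit h𝔭' hSf'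
    hna θsub θquot hpair
  obtain ⟨hθs, -, hne1s, -⟩ := hchar θsub (Or.inl rfl)
  obtain ⟨hθq, -, hne1q, -⟩ := hchar θquot (Or.inr rfl)
  have hbs := StrictEqUnramifiedCentral.grSelmer_charModule_eq_unrSelmer κ 𝔭' (∅ : Set (HeightOneSpectrum (𝓞 K))) θsub hθs hne1s
  have hbq := StrictEqUnramifiedCentral.grSelmer_charModule_eq_unrSelmer κ 𝔭' (∅ : Set (HeightOneSpectrum (𝓞 K))) θquot hθq hne1q
  refine ⟨?_, hle⟩
  -- transport the count to the unramified duals `Dsub`, `Dquot` (same `Λ`-modules); `X11b.XAc = Castella2018.XAc` is `rfl`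
  have P1 : ∀ G : GrDualData κ (charModule (∅ : Set (PadicAlgCl 3)) θquot) 𝔭' (∅ : Set (HeightOneSpectrum (𝓞 K))) γ,
      Literature.NumberTheory.EllipticCurves.lambdaInvariant 3 (Summit.BirchSwinnertonDyer.Rank1Residual.X11b.AcSelmer.XAc (W.baseChange K) 3 κ 𝔭' ∅ γ) +
          Literature.NumberTheory.EllipticCurves.zpCorank (↥(Summit.BirchSwinnertonDyer.Rank1Residual.X11b.AcSelmer.selmerAc (W.baseChange K) 3 κ 𝔭' (↑Sf' : Set (IsDedekindDomain.HeightOneSpectrum (NumberField.RingOfIntegers K)))) ⧸ (Summit.BirchSwinnertonDyer.Rank1Residual.X11b.AcSelmer.selmerAc (W.baseChange K) 3 κ 𝔭' (∅ : Set (IsDedekindDomain.HeightOneSpectrum (NumberField.RingOfIntegers K)))).addSubgroupOf (Summit.BirchSwinnertonDyer.Rank1Residual.X11b.AcSelmer.selmerAc (W.baseChange K) 3 κ 𝔭' (↑Sf' : Set (IsDedekindDomain.HeightOneSpectrum (NumberField.RingOfIntegers K))))) 3 =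
        Literature.NumberTheory.EllipticCurves.lambdaInvariant 3 Dsub.X + Literature.NumberTheory.EllipticCurves.lambdaInvariant 3 G.X +
          ∑ w ∈ Sf', (Literature.NumberTheory.EllipticCurves.KellerYin2024.charLocalLambda (∅ : Set (PadicAlgCl 3)) κ θsub w + Literature.NumberTheory.EllipticCurves.KellerYin2024.charLocalLambda (∅ : Set (PadicAlgCl 3)) κ θquot w) := fun G ↦
    StrictEqUnramifiedCentral.prop_datumDualData_of_forall_grDualData κ 𝔭' (∅ : Set (HeightOneSpectrum (𝓞 K))) hbs
      (fun X _ _ ↦ Literature.NumberTheory.EllipticCurves.lambdaInvariant 3 (Summit.BirchSwinnertonDyer.Rank1Residual.X11b.AcSelmer.XAc (W.baseChange K) 3 κ 𝔭' ∅ γ) +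
          Literature.NumberTheory.EllipticCurves.zpCorank (↥(Summit.BirchSwinnertonDyer.Rank1Residual.X11b.AcSelmer.selmerAc (W.baseChange K) 3 κ 𝔭' (↑Sf' : Set (IsDedekindDomain.HeightOneSpectrum (NumberField.RingOfIntegers K)))) ⧸ (Summit.BirchSwinnertonDyer.Rank1Residual.X11b.AcSelmer.selmerAc (W.baseChange K) 3 κ 𝔭' (∅ : Set (IsDedekindDomain.HeightOneSpectrum (NumberField.RingOfIntegers K)))).addSubgroupOf (Summit.BirchSwinnertonDyer.Rank1Residual.X11b.AcSelmer.selmerAc (W.baseChange K) 3 κ 𝔭' (↑Sf' : Set (IsDedekindDomain.HeightOneSpectrum (NumberField.RingOfIntegers K))))) 3 =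
        Literature.NumberTheory.EllipticCurves.lambdaInvariant 3 X + Literature.NumberTheory.EllipticCurves.lambdaInvariant 3 G.X +
          ∑ w ∈ Sf', (Literature.NumberTheory.EllipticCurves.KellerYin2024.charLocalLambda (∅ : Set (PadicAlgCl 3)) κ θsub w + Literature.NumberTheory.EllipticCurves.KellerYin2024.charLocalLambda (∅ : Set (PadicAlgCl 3)) κ θquot w))
      (fun G' ↦ key G' G) Dsub
  exact StrictEqUnramifiedCentral.prop_datumDualData_of_forall_grDualData κ 𝔭' (∅ : Set (HeightOneSpectrum (𝓞 K))) hbq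
    (fun X _ _ ↦ Literature.NumberTheory.EllipticCurves.lambdaInvariant 3 (Summit.BirchSwinnertonDyer.Rank1Residual.X11b.AcSelmer.XAc (W.baseChange K) 3 κ 𝔭' ∅ γ) +
          Literature.NumberTheory.EllipticCurves.zpCorank (↥(Summit.BirchSwinnertonDyer.Rank1Residual.X11b.AcSelmer.selmerAc (W.baseChange K) 3 κ 𝔭' (↑Sf' : Set (IsDedekindDomain.HeightOneSpectrum (NumberField.RingOfIntegers K)))) ⧸ (Summit.BirchSwinnertonDyer.Rank1Residual.X11b.AcSelmer.selmerAc (W.baseChange K) 3 κ 𝔭' (∅ : Set (IsDedekindDomain.HeightOneSpectrum (NumberField.RingOfIntegers K)))).addSubgroupOf (Summit.BirchSwinnertonDyer.Rank1Residual.X11b.AcSelmer.selmerAc (W.baseChange K) 3 κ 𝔭' (↑Sf' : Set (IsDedekindDomain.HeightOneSpectrum (NumberField.RingOfIntegers K))))) 3 =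
        Literature.NumberTheory.EllipticCurves.lambdaInvariant 3 Dsub.X + Literature.NumberTheory.EllipticCurves.lambdaInvariant 3 X +
          ∑ w ∈ Sf', (Literature.NumberTheory.EllipticCurves.KellerYin2024.charLocalLambda (∅ : Set (PadicAlgCl 3)) κ θsub w + Literature.NumberTheory.EllipticCurves.KellerYin2024.charLocalLambda (∅ : Set (PadicAlgCl 3)) κ θquot w))
    P1 Dquot

/-- **DOOR HALF of [ALG-λ] on the Leopoldt cell, modulo FOUR published facts by name (CGLS 2022 Prop. 1.2.5 module clause, Prop. 14, Cor. 1.2.6 ×2):**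
`λ(𝔛_{θsub}) + λ(𝔛_{θquot}) + Σ_{w∣N}(λ𝒫_w(θsub) + λ𝒫_w(θquot)) ≤ λ(X_{∅,0}(𝔭′)) + Σ_{w∣N} λ𝒫_w(f)` for the UNRAMIFIED primitive
character duals of the stub (binders of `stub_algLambdaFormula` VERBATIM; the places above 3 carry zero terms on both sides, p704504).
CONDITIONAL; closes nothing. [cite: CastellaGrossiLeeSkinner2022, Thm. 1.5.1 and §1.4] [cite: GreenbergVatsal2000, §2 Prop. (2.4)] -/
theorem door_ofCGLS
    (hprop125 : prop125_characterGrSelmerDual_torsion_muZero_dim) (hfact : prop14_residualCharacterSelmer_finite)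
    (hlift : cor126_residualCharacter_globalLift) (hlocal : cor126_residualCharacter_localSurjective) :
    ∀ (W : WeierstrassCurve ℚ) [W.IsElliptic] [W.IsGloballyMinimal] (N : ℕ) [NeZero N] (K : Type) [Field K] [NumberField K], Summit.BirchSwinnertonDyer.Rank1Residual.Additive.ClassO6 W 3 → Literature.NumberTheory.EllipticCurves.Rank1Residual.Red W 3 → (∃ Φ : AddSubgroup (WeierstrassCurve.geomTorsion W ((3 : ℕ) : ℤ)), Literature.NumberTheory.EllipticCurves.Rank1Residual.IsRationalLine W 3 Φ ∧ ∀ (v : IsDedekindDomain.HeightOneSpectrum (NumberField.RingOfIntegers ℚ)), ((3 : ℕ) : NumberField.RingOfIntegers ℚ) ∈ v.asIdeal → ∀ 𝔓 ∈ v.primesAbove, ¬ (∀ g ∈ 𝔓.decompositionSubgroup (Field.absoluteGaloisGroup ℚ), ∀ P ∈ Φ, g • P = P) ∧ ¬ (∀ g ∈ 𝔓.decompositionSubgroup (Field.absoluteGaloisGroup ℚ), ∀ P : WeierstrassCurve.geomTorsion W ((3 : ℕ) : ℤ), g • P - P ∈ Φ)) → W.conductorNorm ℤ = N → Literature.NumberTheory.EllipticCurves.IsImaginaryQuadratic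 K → Literature.NumberTheory.EllipticCurves.SatisfiesHeegnerHypothesis N K → Odd (NumberField.discr K) → (∀ Q : (W.baseChange K).toAffine.Point, (3 : ℕ) • Q = 0 → Q = 0) → ∀ (κ : Literature.NumberTheory.EllipticCurves.ZpExtension K 3), κ.IsAnticyclotomic → ∀ (γ : Field.absoluteGaloisGroup K) [Fact (κ.IsTopGenerator γ)] (𝔭 : IsDedekindDomain.HeightOneSpectrum (NumberField.RingOfIntegers K)), ((3 : ℕ) : NumberField.RingOfIntegers K) ∈ 𝔭.asIdeal → 𝔭.asIdeal.ramificationIdx (NumberField.RingOfIntegers ℚ) = 1 → 𝔭.asIdeal.inertiaDeg (NumberField.RingOfIntegers ℚ) = 1 → ∀ (𝔭' : IsDedekindDomain.HeightOneSpectrum (NumberField.RingOfIntegers K)), ((3 : ℕ) : NumberField.RingOfIntegers K) ∈ 𝔭'.asIdeal → 𝔭' ≠ 𝔭 → ∀ (θsub θquot : FramedGaloisRep K (padicCoeffIntegers (∅ : Set (PadicAlgCl 3))) 1), Literature.NumberTheory.EllipticCurves.KellerYin2024.IsResidualPairOver (W.baseChange K) 3 θsub θquot → ∀ (Sf : Finset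 (IsDedekindDomain.HeightOneSpectrum (NumberField.RingOfIntegers K))), (∀ w : IsDedekindDomain.HeightOneSpectrum (NumberField.RingOfIntegers K), w ∈ Sf ↔ ((W.conductorNorm ℤ : ℤ) : NumberField.RingOfIntegers K) ∈ w.asIdeal) → ∀ (Dsub : Literature.NumberTheory.EllipticCurves.GreenbergVatsal2000.DatumDualData κ γ (Literature.NumberTheory.EllipticCurves.KellerYin2024.charModule (∅ : Set (PadicAlgCl 3)) θsub) (Literature.NumberTheory.EllipticCurves.Castella2018.AcSelmer.bdpData (Literature.NumberTheory.EllipticCurves.KellerYin2024.charModule (∅ : Set (PadicAlgCl 3)) θsub) 3 𝔭') ∅) (Dquot : Literature.NumberTheory.EllipticCurves.GreenbergVatsal2000.DatumDualData κ γ (Literature.NumberTheory.EllipticCurves.KellerYin2024.charModule (∅ : Set (PadicAlgCl 3)) θquot) (Literature.NumberTheory.EllipticCurves.Castella2018.AcSelmer.bdpData (Literature.NumberTheory.EllipticCurves.KellerYin2024.charModule (∅ : Set (PadicAlgCl 3)) θquot) 3 𝔭') ∅),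
      Literature.NumberTheory.EllipticCurves.lambdaInvariant 3 Dsub.X + Literature.NumberTheory.EllipticCurves.lambdaInvariant 3 Dquot.X + ∑ w ∈ Sf, (Literature.NumberTheory.EllipticCurves.KellerYin2024.charLocalLambda (∅ : Set (PadicAlgCl 3)) κ θsub w + Literature.NumberTheory.EllipticCurves.KellerYin2024.charLocalLambda (∅ : Set (PadicAlgCl 3)) κ θquot w) ≤
      Literature.NumberTheory.EllipticCurves.lambdaInvariant 3 (Summit.BirchSwinnertonDyer.Rank1Residual.X11b.AcSelmer.XAc (W.baseChange K) 3 κ 𝔭' ∅ γ) + ∑ w ∈ Sf, Literature.NumberTheory.EllipticCurves.KellerYin2024.curveLocalLambda κ (W.baseChange K) w := by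
  intro W _ _ N _ K _ _ hO6 hRed hcell hN hK hHN hodd hEK κ hκ γ hγI 𝔭 h𝔭 he hf 𝔭' h𝔭' hne θsub θquot hpair Sf hSf Dsub Dquot
  haveI : Fact (Nat.Prime 3) := ⟨Nat.prime_three⟩
  have hSf' : ∀ w : HeightOneSpectrum (𝓞 K), w ∈ Sf.filter (fun w ↦ ((3 : ℕ) : 𝓞 K) ∉ w.asIdeal) ↔
      (((W.conductorNorm ℤ : ℤ) : 𝓞 K) ∈ w.asIdeal ∧ ((3 : ℕ) : 𝓞 K) ∉ w.asIdeal) := fun w ↦ by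
    rw [Finset.mem_filter, hSf]
  obtain ⟨heq, hle⟩ := door_identity_and_le_ofCGLS hprop125 hfact hlift hlocal W N K hO6 hRed hcell hN hK
    hHN hodd hEK κ hκ γ 𝔭 h𝔭 he hf 𝔭' h𝔭' hne θsub θquot hpair Sf hSf Dsub Dquot _ hSf'
  rw [EisensteinCongruenceCoreAtThreeLocalTermsAtP.sum_curveLocalLambda_eq_sum_filter κ (W.baseChange K) Sf,
    Finset.sum_add_distrib, EisensteinCongruenceCoreAtThreeLocalTermsAtP.sum_charLocalLambda_eq_sum_filter _ κ θsub Sf,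
    EisensteinCongruenceCoreAtThreeLocalTermsAtP.sum_charLocalLambda_eq_sum_filter _ κ θquot Sf, ← Finset.sum_add_distrib]
  omega

/-- **[ALG-λ] ⟺ the curve-side relaxation count, modulo FOUR published facts by name (CGLS only):** at the stub's binders and for every
`Sf′` = the places over `N` prime to 3, `λ(X_{∅,0}(𝔭′)) + Σ_{w∣N} λ𝒫_w(f) = λ(𝔛_{θsub}) + λ(𝔛_{θquot}) + Σ_{w∣N}(…)` ⟺
`corank_{ℤ_3}(Sel_{𝔭′}^{Sf′}/Sel_{𝔭′}^∅)(E_K) = Σ_{w∈Sf′} λ𝒫_w(f)`. CONDITIONAL; closes nothing.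
[cite: CastellaGrossiLeeSkinner2022, Thm. 1.5.1, (eq:1)] [cite: KellerYin2024, Rem. 1.4.2 (arXiv:2402.12781v2)] [cite: GreenbergVatsal2000, §2 Prop. (2.4)] -/
theorem formula_iff_corank_ofCGLS
    (hprop125 : prop125_characterGrSelmerDual_torsion_muZero_dim) (hfact : prop14_residualCharacterSelmer_finite)
    (hlift : cor126_residualCharacter_globalLift) (hlocal : cor126_residualCharacter_localSurjective) :
    ∀ (W : WeierstrassCurve ℚ) [W.IsElliptic] [W.IsGloballyMinimal] (N : ℕ) [NeZero N] (K : Type) [Field K] [NumberField K], Summit.BirchSwinnertonDyer.Rank1Residual.Additive.ClassO6 W 3 → Literature.NumberTheory.EllipticCurves.Rank1Residual.Red W 3 → (∃ Φ : AddSubgroup (WeierstrassCurve.geomTorsion W ((3 : ℕ) : ℤ)), Literature.NumberTheory.EllipticCurves.Rank1Residual.IsRationalLine W 3 Φ ∧ ∀ (v : IsDedekindDomain.HeightOneSpectrum (NumberField.RingOfIntegers ℚ)), ((3 : ℕ) : NumberField.RingOfIntegers ℚ) ∈ v.asIdeal → ∀ 𝔓 ∈ v.primesAbove, ¬ (∀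 g ∈ 𝔓.decompositionSubgroup (Field.absoluteGaloisGroup ℚ), ∀ P ∈ Φ, g • P = P) ∧ ¬ (∀ g ∈ 𝔓.decompositionSubgroup (Field.absoluteGaloisGroup ℚ), ∀ P : WeierstrassCurve.geomTorsion W ((3 : ℕ) : ℤ), g • P - P ∈ Φ)) → W.conductorNorm ℤ = N → Literature.NumberTheory.EllipticCurves.IsImaginaryQuadratic K → Literature.NumberTheory.EllipticCurves.SatisfiesHeegnerHypothesis N K → Odd (NumberField.discr K) → (∀ Q : (W.baseChange K).toAffine.Point, (3 : ℕ) • Q = 0 → Q = 0) → ∀ (κ : Literature.NumberTheory.EllipticCurves.ZpExtension K 3), κ.IsAnticyclotomic → ∀ (γ : Field.absoluteGaloisGroup K) [Fact (κ.IsTopGenerator γ)] (𝔭 : IsDedekindDomain.HeightOneSpectrum (NumberField.RingOfIntegers K)), ((3 : ℕ) : NumberField.RingOfIntegers K) ∈ 𝔭.asIdeal → 𝔭.asIdeal.ramificationIdx (NumberField.RingOfIntegers ℚ) = 1 → 𝔭.asIdeal.inertiaDeg (NumberField.RingOfIntegers ℚ) = 1 → ∀ (𝔭' : IsDedekindDomain.HeightOneSpectrum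 (NumberField.RingOfIntegers K)), ((3 : ℕ) : NumberField.RingOfIntegers K) ∈ 𝔭'.asIdeal → 𝔭' ≠ 𝔭 → ∀ (θsub θquot : FramedGaloisRep K (padicCoeffIntegers (∅ : Set (PadicAlgCl 3))) 1), Literature.NumberTheory.EllipticCurves.KellerYin2024.IsResidualPairOver (W.baseChange K) 3 θsub θquot → ∀ (Sf : Finset (IsDedekindDomain.HeightOneSpectrum (NumberField.RingOfIntegers K))), (∀ w : IsDedekindDomain.HeightOneSpectrum (NumberField.RingOfIntegers K), w ∈ Sf ↔ ((W.conductorNorm ℤ : ℤ) : NumberField.RingOfIntegers K) ∈ w.asIdeal) → ∀ (Dsub : Literature.NumberTheory.EllipticCurves.GreenbergVatsal2000.DatumDualData κ γ (Literature.NumberTheory.EllipticCurves.KellerYin2024.charModule (∅ : Set (PadicAlgCl 3)) θsub) (Literature.NumberTheory.EllipticCurves.Castella2018.AcSelmer.bdpData (Literature.NumberTheory.EllipticCurves.KellerYin2024.charModule (∅ : Set (PadicAlgCl 3)) θsub) 3 𝔭') ∅) (Dquot : Literature.NumberTheory.EllipticCurves.GreenbergVatsal2000.DatumDualData κ γ (Literature.NumberTheory.EllipticCurves.KellerYin2024.charModule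 (∅ : Set (PadicAlgCl 3)) θquot) (Literature.NumberTheory.EllipticCurves.Castella2018.AcSelmer.bdpData (Literature.NumberTheory.EllipticCurves.KellerYin2024.charModule (∅ : Set (PadicAlgCl 3)) θquot) 3 𝔭') ∅),
      ∀ (Sf' : Finset (IsDedekindDomain.HeightOneSpectrum (NumberField.RingOfIntegers K))), (∀ w : IsDedekindDomain.HeightOneSpectrum (NumberField.RingOfIntegers K), w ∈ Sf' ↔ (((W.conductorNorm ℤ : ℤ) : NumberField.RingOfIntegers K) ∈ w.asIdeal ∧ ((3 : ℕ) : NumberField.RingOfIntegers K) ∉ w.asIdeal)) →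
      ((Literature.NumberTheory.EllipticCurves.lambdaInvariant 3 (Summit.BirchSwinnertonDyer.Rank1Residual.X11b.AcSelmer.XAc (W.baseChange K) 3 κ 𝔭' ∅ γ) + ∑ w ∈ Sf, Literature.NumberTheory.EllipticCurves.KellerYin2024.curveLocalLambda κ (W.baseChange K) w = Literature.NumberTheory.EllipticCurves.lambdaInvariant 3 Dsub.X + Literature.NumberTheory.EllipticCurves.lambdaInvariant 3 Dquot.X + ∑ w ∈ Sf, (Literature.NumberTheory.EllipticCurves.KellerYin2024.charLocalLambda (∅ : Set (PadicAlgCl 3)) κ θsub w + Literature.NumberTheory.EllipticCurves.KellerYin2024.charLocalLambda (∅ : Set (PadicAlgCl 3)) κ θquot w)) ↔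
        Literature.NumberTheory.EllipticCurves.zpCorank (↥(Summit.BirchSwinnertonDyer.Rank1Residual.X11b.AcSelmer.selmerAc (W.baseChange K) 3 κ 𝔭' (↑Sf' : Set (IsDedekindDomain.HeightOneSpectrum (NumberField.RingOfIntegers K)))) ⧸ (Summit.BirchSwinnertonDyer.Rank1Residual.X11b.AcSelmer.selmerAc (W.baseChange K) 3 κ 𝔭' (∅ : Set (IsDedekindDomain.HeightOneSpectrum (NumberField.RingOfIntegers K)))).addSubgroupOf (Summit.BirchSwinnertonDyer.Rank1Residual.X11b.AcSelmer.selmerAc (W.baseChange K) 3 κ 𝔭' (↑Sf' : Set (IsDedekindDomain.HeightOneSpectrum (NumberField.RingOfIntegers K))))) 3 =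
          ∑ w ∈ Sf', Literature.NumberTheory.EllipticCurves.KellerYin2024.curveLocalLambda κ (W.baseChange K) w) := by
  intro W _ _ N _ K _ _ hO6 hRed hcell hN hK hHN hodd hEK κ hκ γ hγI 𝔭 h𝔭 he hf 𝔭' h𝔭' hne θsub θquot hpair Sf hSf Dsub Dquot Sf' hSf'
  haveI : Fact (Nat.Prime 3) := ⟨Nat.prime_three⟩
  obtain ⟨heq, -⟩ := door_identity_and_le_ofCGLS hprop125 hfact hlift hlocal W N K hO6 hRed hcell hN hK
    hHN hodd hEK κ hκ γ 𝔭 h𝔭 he hf 𝔭' h𝔭' hne θsub θquot hpair Sf hSf Dsub Dquot Sf' hSf'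
  have hfil : Sf.filter (fun w ↦ ((3 : ℕ) : 𝓞 K) ∉ w.asIdeal) = Sf' := by
    ext w
    rw [Finset.mem_filter, hSf, hSf']
  rw [EisensteinCongruenceCoreAtThreeLocalTermsAtP.sum_curveLocalLambda_eq_sum_filter κ (W.baseChange K) Sf,
    Finset.sum_add_distrib, EisensteinCongruenceCoreAtThreeLocalTermsAtP.sum_charLocalLambda_eq_sum_filter _ κ θsub Sf,
    EisensteinCongruenceCoreAtThreeLocalTermsAtP.sum_charLocalLambda_eq_sum_filter _ κ θquot Sf, ← Finset.sum_add_distrib]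
  rw [hfil]
  omega

/-- **[ALG-λ] from PRINT (CGLS ×4) and the `≥` half of the curve-side relaxation count.** At the stub's binders: the four published facts
and «for every `Sf′` = the places over `N` prime to 3, `Σ_{w∈Sf′} λ𝒫_w(f) ≤ corank_{ℤ_3}(Sel_{𝔭′}^{Sf′}/Sel_{𝔭′}^∅)(E_K)`» (Greenberg–Vatsal
Prop. 2.4 / Pollack–Weston Prop. A.2 for `E[3^∞]` over `K_∞^{ac}` at the tame bad places — the ONE remaining port of [ALG]) give CGLS
Thm. 1.5.1's λ-formula VERBATIM. CONDITIONAL; closes nothing. [cite: CastellaGrossiLeeSkinner2022, Thm. 1.5.1]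
[cite: PollackWeston2011, App. A Prop. A.2] [cite: GreenbergVatsal2000, §2 Prop. (2.4)] -/
theorem formula_ofCGLS_of_corankGe
    (hprop125 : prop125_characterGrSelmerDual_torsion_muZero_dim) (hfact : prop14_residualCharacterSelmer_finite)
    (hlift : cor126_residualCharacter_globalLift) (hlocal : cor126_residualCharacter_localSurjective) :
    ∀ (W : WeierstrassCurve ℚ) [W.IsElliptic] [W.IsGloballyMinimal] (N : ℕ) [NeZero N] (K : Type) [Field K] [NumberField K], Summit.BirchSwinnertonDyer.Rank1Residual.Additive.ClassO6 W 3 → Literature.NumberTheory.EllipticCurves.Rank1Residual.Red W 3 → (∃ Φ : AddSubgroup (WeierstrassCurve.geomTorsion W ((3 : ℕ) : ℤ)), Literature.NumberTheory.EllipticCurves.Rank1Residual.IsRationalLine W 3 Φ ∧ ∀ (v : IsDedekindDomain.HeightOneSpectrum (NumberField.RingOfIntegers ℚ)), ((3 : ℕ) : NumberField.RingOfIntegers ℚ) ∈ v.asIdeal → ∀ 𝔓 ∈ v.primesAbove, ¬ (∀ g ∈ 𝔓.decompositionSubgroup (Field.absoluteGaloisGroup ℚ), ∀ P ∈ Φ,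 g • P = P) ∧ ¬ (∀ g ∈ 𝔓.decompositionSubgroup (Field.absoluteGaloisGroup ℚ), ∀ P : WeierstrassCurve.geomTorsion W ((3 : ℕ) : ℤ), g • P - P ∈ Φ)) → W.conductorNorm ℤ = N → Literature.NumberTheory.EllipticCurves.IsImaginaryQuadratic K → Literature.NumberTheory.EllipticCurves.SatisfiesHeegnerHypothesis N K → Odd (NumberField.discr K) → (∀ Q : (W.baseChange K).toAffine.Point, (3 : ℕ) • Q = 0 → Q = 0) → ∀ (κ : Literature.NumberTheory.EllipticCurves.ZpExtension K 3), κ.IsAnticyclotomic → ∀ (γ : Field.absoluteGaloisGroup K) [Fact (κ.IsTopGenerator γ)] (𝔭 : IsDedekindDomain.HeightOneSpectrum (NumberField.RingOfIntegers K)), ((3 : ℕ) : NumberField.RingOfIntegers K) ∈ 𝔭.asIdeal → 𝔭.asIdeal.ramificationIdx (NumberField.RingOfIntegers ℚ) = 1 → 𝔭.asIdeal.inertiaDeg (NumberField.RingOfIntegers ℚ) = 1 → ∀ (𝔭' : IsDedekindDomain.HeightOneSpectrum (NumberField.RingOfIntegers K)), ((3 : ℕ) : NumberField.RingOfIntegers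 K) ∈ 𝔭'.asIdeal → 𝔭' ≠ 𝔭 → ∀ (θsub θquot : FramedGaloisRep K (padicCoeffIntegers (∅ : Set (PadicAlgCl 3))) 1), Literature.NumberTheory.EllipticCurves.KellerYin2024.IsResidualPairOver (W.baseChange K) 3 θsub θquot → ∀ (Sf : Finset (IsDedekindDomain.HeightOneSpectrum (NumberField.RingOfIntegers K))), (∀ w : IsDedekindDomain.HeightOneSpectrum (NumberField.RingOfIntegers K), w ∈ Sf ↔ ((W.conductorNorm ℤ : ℤ) : NumberField.RingOfIntegers K) ∈ w.asIdeal) → ∀ (Dsub : Literature.NumberTheory.EllipticCurves.GreenbergVatsal2000.DatumDualData κ γ (Literature.NumberTheory.EllipticCurves.KellerYin2024.charModule (∅ : Set (PadicAlgCl 3)) θsub) (Literature.NumberTheory.EllipticCurves.Castella2018.AcSelmer.bdpData (Literature.NumberTheory.EllipticCurves.KellerYin2024.charModule (∅ : Set (PadicAlgCl 3)) θsub) 3 𝔭') ∅) (Dquot : Literature.NumberTheory.EllipticCurves.GreenbergVatsal2000.DatumDualData κ γ (Literature.NumberTheory.EllipticCurves.KellerYin2024.charModule (∅ : Set (PadicAlgCl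 3)) θquot) (Literature.NumberTheory.EllipticCurves.Castella2018.AcSelmer.bdpData (Literature.NumberTheory.EllipticCurves.KellerYin2024.charModule (∅ : Set (PadicAlgCl 3)) θquot) 3 𝔭') ∅),
      (∀ (Sf' : Finset (IsDedekindDomain.HeightOneSpectrum (NumberField.RingOfIntegers K))), (∀ w : IsDedekindDomain.HeightOneSpectrum (NumberField.RingOfIntegers K), w ∈ Sf' ↔ (((W.conductorNorm ℤ : ℤ) : NumberField.RingOfIntegers K) ∈ w.asIdeal ∧ ((3 : ℕ) : NumberField.RingOfIntegers K) ∉ w.asIdeal)) →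
        ∑ w ∈ Sf', Literature.NumberTheory.EllipticCurves.KellerYin2024.curveLocalLambda κ (W.baseChange K) w ≤
          Literature.NumberTheory.EllipticCurves.zpCorank (↥(Summit.BirchSwinnertonDyer.Rank1Residual.X11b.AcSelmer.selmerAc (W.baseChange K) 3 κ 𝔭' (↑Sf' : Set (IsDedekindDomain.HeightOneSpectrum (NumberField.RingOfIntegers K)))) ⧸ (Summit.BirchSwinnertonDyer.Rank1Residual.X11b.AcSelmer.selmerAc (W.baseChange K) 3 κ 𝔭' (∅ : Set (IsDedekindDomain.HeightOneSpectrum (NumberField.RingOfIntegers K)))).addSubgroupOf (Summit.BirchSwinnertonDyer.Rank1Residual.X11b.AcSelmer.selmerAc (W.baseChange K) 3 κ 𝔭' (↑Sf' : Set (IsDedekindDomain.HeightOneSpectrum (NumberField.RingOfIntegers K))))) 3) →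
      Literature.NumberTheory.EllipticCurves.lambdaInvariant 3 (Summit.BirchSwinnertonDyer.Rank1Residual.X11b.AcSelmer.XAc (W.baseChange K) 3 κ 𝔭' ∅ γ) + ∑ w ∈ Sf, Literature.NumberTheory.EllipticCurves.KellerYin2024.curveLocalLambda κ (W.baseChange K) w = Literature.NumberTheory.EllipticCurves.lambdaInvariant 3 Dsub.X + Literature.NumberTheory.EllipticCurves.lambdaInvariant 3 Dquot.X + ∑ w ∈ Sf, (Literature.NumberTheory.EllipticCurves.KellerYin2024.charLocalLambda (∅ : Set (PadicAlgCl 3)) κ θsub w + Literature.NumberTheory.EllipticCurves.KellerYin2024.charLocalLambda (∅ : Set (PadicAlgCl 3)) κ θquot w) := by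
  intro W _ _ N _ K _ _ hO6 hRed hcell hN hK hHN hodd hEK κ hκ γ hγI 𝔭 h𝔭 he hf 𝔭' h𝔭' hne θsub θquot hpair Sf hSf Dsub Dquot hge
  haveI : Fact (Nat.Prime 3) := ⟨Nat.prime_three⟩
  have hSf' : ∀ w : HeightOneSpectrum (𝓞 K), w ∈ Sf.filter (fun w ↦ ((3 : ℕ) : 𝓞 K) ∉ w.asIdeal) ↔
      (((W.conductorNorm ℤ : ℤ) : 𝓞 K) ∈ w.asIdeal ∧ ((3 : ℕ) : 𝓞 K) ∉ w.asIdeal) := fun w ↦ by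
    rw [Finset.mem_filter, hSf]
  obtain ⟨-, hle⟩ := door_identity_and_le_ofCGLS hprop125 hfact hlift hlocal W N K hO6 hRed hcell hN hK
    hHN hodd hEK κ hκ γ 𝔭 h𝔭 he hf 𝔭' h𝔭' hne θsub θquot hpair Sf hSf Dsub Dquot _ hSf'
  exact (formula_iff_corank_ofCGLS hprop125 hfact hlift hlocal W N K hO6 hRed hcell hN hK hHN hodd hEK κ
    hκ γ 𝔭 h𝔭 he hf 𝔭' h𝔭' hne θsub θquot hpair Sf hSf Dsub Dquot _ hSf').2 (le_antisymm hle (hge _ hSf'))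

end Summit.BirchSwinnertonDyer.BirchSwinnertonDyer.Theorems.EisensteinCharacterInvariantsAtThreeAlgLambdaDoorOfCGLS

end
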